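import Mathlib.GroupTheory.Nilpotent
import Mathlib.GroupTheory.QuotientGroup.Basic
import Mathlib.GroupTheory.OrderOfElement
import Mathlib.Combinatorics.Pigeonhole
import HarnessLib

/-!
# Finitely generated nilpotent groups with at most one independent character have FINITE commutator subgroup

builds on p205010 (kernel theorem, internal audit signed; external expert review pending) — nothing in this file uses p205010.
Lane `prim-bschramm`, seat `prim-bschramm-p4` gen 21 (PART C3 of `P4-GENERAL.md` §43).  Helper file
(`--supports stmt-CriticalPhenomena-4575 --as helper`).  Pure group theory (no percolation).

THE LEMMA (`NilBetti.commutator_finite`).  Let `G` be generated by a finite set `A`, nilpotent (`γ_{c+1}(G) = 1`), and suppose there are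
`z ∈ G` and an integer `μ ≠ 0` with `g ^ μ * z ^ k ∈ [G, G]` for every `g` and some `k = k(g)` — i.e. the abelianisation is cyclic up to bounded
torsion (the case "at most one independent character `G → ℤ`").  Then `[G, G]` is FINITE.  The sequel file (`CayleyNilpotentBSConj`) turns this
into `p_c = 1` for all Cayley graphs of such groups, so that for a finitely generated NILPOTENT group Benjamini–Schramm's hypothesis `p_c < 1`
already supplies the two independent characters (`b₁ ≥ 2`) that the C3 conditional theorem needs.
PROOF (textbook bilinearity of `γ_n/γ_{n+1} × G/[G,G] → γ_{n+1}/γ_{n+2}`): modulo `γ_{n+2}` the commutator `⁅h, g⁆` (`h ∈ γ_n`) is multiplicative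
in `g` (`mk_commutator_mul_right`) and in `h` (`mk_commutator_mul_left`) and central; so `γ_{n+1}/γ_{n+2}` is generated by the finitely many pairwise commuting elements
`⁅h_j, a⁆` (`h_j` coset representatives of `γ_n` mod `γ_{n+1}`, `a ∈ A`), each of finite order (`h_j ^ M ∈ γ_{n+1}`); a finite set of commuting
torsion elements generates a finite group (`finite_closure_of_comm`); at the bottom `⁅a, a'⁆ ^ {μ²} ≡ ⁅a ^ μ, a' ^ μ⁆ ≡ ⁅z, z⁆ ^ {kk'} = 1`.
Hence every `γ_n/γ_{n+1}` (`n ≥ 1`) is finite, and `γ_{c+1} = 1`.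
§1 `finite_closure_of_comm` · §2 multiplicativity of `⁅h, g⁆ mod γ_{n+2}` in each variable, power laws · §3 `covered_one`, `covered_succ` · §4 **`commutator_finite`**.
[cite: MilnorSolvableGrowth1968, Lemma 1 pp. 447–448] [cite: BenjaminiSchramm1996, Conj. 4; §2 (Cayley graphs)]
-/

namespace Summit.CriticalPhenomena.PercolationContinuityZ3.Theorems.Transplant
namespace NilBetti

open scoped commutatorElement

variable {G : Type*} [Group G]

/-! ## §1 A finite set of pairwise commuting torsion elements generates a finite subgroup -/

/-- **A finite set of pairwise commuting elements of finite order generates a finite subgroup.** [folklore] -/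
theorem finite_closure_of_comm (E : Finset G) (hcomm : ∀ x ∈ E, ∀ y ∈ E, Commute x y) (hfin : ∀ x ∈ E, IsOfFinOrder x) :
    ((Subgroup.closure (E : Set G) : Subgroup G) : Set G).Finite := by
  classical
  induction E using Finset.induction_on with
  | empty =>
    rw [Finset.coe_empty, Subgroup.closure_empty]
    exact (Set.finite_singleton (1 : G)).subset fun x hx => by simpa using hx
  | @insert e E _ ih =>
    have ihE := ih (fun x hx y hy => hcomm x (Finset.mem_insert_of_mem hx) y (Finset.mem_insert_of_mem hy))
      fun x hx => hfin x (Finset.mem_insert_of_mem hx)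
    have heo : IsOfFinOrder e := hfin e (Finset.mem_insert_self e E)
    have ho : 0 < orderOf e := heo.orderOf_pos
    -- `e` commutes with the Subgroup.closure of `E`
    have hce : ∀ y ∈ Subgroup.closure (E : Set G), Commute e y := by
      intro y hy
      induction hy using Subgroup.closure_induction with
      | mem x hx => exact hcomm e (Finset.mem_insert_self e E) x (Finset.mem_insert_of_mem hx)
      | one => exact Commute.one_right e
      | mul x y _ _ hx hy => exact hx.mul_right hy
      | inv x _ hx => exact hx.inv_right
    -- the finite candidate set `{e ^ i * y : i < orderOf e, y ∈ Subgroup.closure E}`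
    set P : Set G := Set.image2 (fun i y => e ^ i * y) (↑(Finset.range (orderOf e)) : Set ℕ) (Subgroup.closure (E : Set G) : Set G) with hP
    have hPfin : P.Finite := Set.Finite.image2 _ (Finset.finite_toSet _) ihE
    have hmemP : ∀ (i : ℕ) (y : G), y ∈ Subgroup.closure (E : Set G) → e ^ i * y ∈ P := fun i y hy =>
      ⟨i % orderOf e, Finset.mem_coe.2 (Finset.mem_range.2 (Nat.mod_lt i ho)), y, hy, by
        show e ^ (i % orderOf e) * y = e ^ i * y
        rw [pow_mod_orderOf]⟩
    refine hPfin.subset fun x hx => ?_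
    rw [Finset.coe_insert] at hx
    induction hx using Subgroup.closure_induction with
    | mem x hx =>
      rcases Set.mem_insert_iff.1 hx with rfl | hxE
      · simpa using hmemP 1 1 (one_mem _)
      · simpa using hmemP 0 x (Subgroup.subset_closure hxE)
    | one => simpa using hmemP 0 1 (one_mem _)
    | mul x y _ _ hx hy =>
      obtain ⟨i, -, u, hu, rfl⟩ := hx
      obtain ⟨j, -, v, hv, rfl⟩ := hy
      show e ^ i * u * (e ^ j * v) ∈ P
      have hc : e ^ j * u = u * e ^ j := ((hce u hu).pow_left j).eq
      rw [show e ^ i * u * (e ^ j * v) = e ^ (i + j) * (u * v) by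
        rw [pow_add, mul_assoc, mul_assoc, ← mul_assoc u, ← hc, mul_assoc]]
      exact hmemP (i + j) (u * v) (mul_mem hu hv)
    | inv x _ hx =>
      obtain ⟨i, -, u, hu, rfl⟩ := hx
      show (e ^ i * u)⁻¹ ∈ P
      have hinv : (e ^ i)⁻¹ = e ^ (i * (orderOf e - 1)) := by
        refine inv_eq_of_mul_eq_one_left ?_
        have hi : i * (orderOf e - 1) + i = orderOf e * i := by
          rw [Nat.mul_sub_one, Nat.sub_add_cancel (Nat.le_mul_of_pos_right i ho), Nat.mul_comm]
        rw [← pow_add, hi, pow_mul, pow_orderOf_eq_one, one_pow]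
      have hc : Commute (e ^ i)⁻¹ u⁻¹ := ((hce u hu).pow_left i).inv_inv
      rw [mul_inv_rev, ← hc.eq, hinv]
      exact hmemP _ _ (inv_mem hu)

/-! ## §2 The lower central series `L n = γ_{n+1}(G)`, centrality one step down, and the two pairing homomorphisms -/

/-- `⁅h, g⁆ ∈ (⊤ : Subgroup G).lowerCentralSeries (n+1)` for `h ∈ (⊤ : Subgroup G).lowerCentralSeries n`. [folklore] -/
theorem commutator_mem_L_succ {n : ℕ} {h : G} (hh : h ∈ (⊤ : Subgroup G).lowerCentralSeries n) (g : G) :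
    ⁅h, g⁆ ∈ (⊤ : Subgroup G).lowerCentralSeries (n + 1) := by
  show ⁅h, g⁆ ∈ (⊤ : Subgroup G).lowerCentralSeries (n + 1)
  rw [Subgroup.lowerCentralSeries_succ]
  exact Subgroup.commutator_mem_commutator hh (Subgroup.mem_top g)

/-- `⁅g, h⁆ ∈ (⊤ : Subgroup G).lowerCentralSeries (n+1)` for `h ∈ (⊤ : Subgroup G).lowerCentralSeries n`. [folklore] -/
theorem commutator_mem_L_succ' {n : ℕ} (g : G) {h : G} (hh : h ∈ (⊤ : Subgroup G).lowerCentralSeries n) :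
    ⁅g, h⁆ ∈ (⊤ : Subgroup G).lowerCentralSeries (n + 1) := by
  rw [← commutatorElement_inv]; exact inv_mem (commutator_mem_L_succ hh g)

/-- `L` is decreasing. [folklore] -/
theorem L_succ_le (n : ℕ) : (⊤ : Subgroup G).lowerCentralSeries (n + 1) ≤ (⊤ : Subgroup G).lowerCentralSeries n :=
  Subgroup.lowerCentralSeries_antitone ⊤ (Nat.le_succ n)

/-- **Centrality one step down**: an element of `L n` is central modulo `L (n+1)`. [folklore] -/
theorem mk_mul_comm {n : ℕ} {x : G} (hx : x ∈ (⊤ : Subgroup G).lowerCentralSeries n) (g : G) :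
    (QuotientGroup.mk (x * g) : G ⧸ (⊤ : Subgroup G).lowerCentralSeries (n + 1)) = QuotientGroup.mk (g * x) := by
  rw [QuotientGroup.eq]
  have h := commutator_mem_L_succ' g⁻¹ (inv_mem hx : x⁻¹ ∈ (⊤ : Subgroup G).lowerCentralSeries n)
  rw [commutatorElement_def, inv_inv, inv_inv] at h
  simpa [mul_assoc] using h

/-- `⁅h, g⁆` is trivial modulo `L (n+2)` as soon as `h ∈ (⊤ : Subgroup G).lowerCentralSeries (n+1)`. [folklore] -/
theorem mk_commutator_eq_one_of_mem {n : ℕ} {h : G} (hh : h ∈ (⊤ : Subgroup G).lowerCentralSeries (n + 1)) (g : G) :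
    (QuotientGroup.mk ⁅h, g⁆ : G ⧸ (⊤ : Subgroup G).lowerCentralSeries (n + 2)) = 1 :=
  (QuotientGroup.eq_one_iff _).2 (commutator_mem_L_succ hh g)

/-- Conjugation by anything fixes `⁅h, g'⁆` modulo `L (n+2)` (`h ∈ (⊤ : Subgroup G).lowerCentralSeries n`). [folklore] -/
theorem mk_conj_commutator {n : ℕ} {h : G} (hh : h ∈ (⊤ : Subgroup G).lowerCentralSeries n) (g g' : G) :
    (QuotientGroup.mk (g * ⁅h, g'⁆ * g⁻¹) : G ⧸ (⊤ : Subgroup G).lowerCentralSeries (n + 2)) = QuotientGroup.mk ⁅h, g'⁆ := by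
  have hc := mk_mul_comm (n := n + 1) (commutator_mem_L_succ hh g') g⁻¹
  have h2 : (QuotientGroup.mk (g * (⁅h, g'⁆ * g⁻¹)) : G ⧸ (⊤ : Subgroup G).lowerCentralSeries (n + 2)) = QuotientGroup.mk (g * (g⁻¹ * ⁅h, g'⁆)) := by
    rw [QuotientGroup.mk_mul ((⊤ : Subgroup G).lowerCentralSeries (n + 2)) g, QuotientGroup.mk_mul ((⊤ : Subgroup G).lowerCentralSeries (n + 2)) g, hc]
  rw [mul_inv_cancel_left] at h2
  rwa [← mul_assoc] at h2

/-- **Right multiplicativity**: for `h ∈ (⊤ : Subgroup G).lowerCentralSeries n`, `⁅h, g g'⁆ ≡ ⁅h, g⁆ ⁅h, g'⁆` modulo `L (n+2)`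
(`⁅h, g g'⁆ = ⁅h, g⁆ · g ⁅h, g'⁆ g⁻¹` and `⁅h, g'⁆ ∈ (⊤ : Subgroup G).lowerCentralSeries (n+1)` is central modulo `L (n+2)`). [folklore] -/
theorem mk_commutator_mul_right {n : ℕ} {h : G} (hh : h ∈ (⊤ : Subgroup G).lowerCentralSeries n) (g g' : G) :
    (QuotientGroup.mk ⁅h, g * g'⁆ : G ⧸ (⊤ : Subgroup G).lowerCentralSeries (n + 2)) = QuotientGroup.mk ⁅h, g⁆ * QuotientGroup.mk ⁅h, g'⁆ := by
  have hid : ⁅h, g * g'⁆ = ⁅h, g⁆ * (g * ⁅h, g'⁆ * g⁻¹) := by simp only [commutatorElement_def]; group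
  rw [hid, QuotientGroup.mk_mul, mk_conj_commutator hh g g']

/-- **Left multiplicativity**: for `h' ∈ (⊤ : Subgroup G).lowerCentralSeries n` (and any `h`), `⁅h h', g⁆ ≡ ⁅h, g⁆ ⁅h', g⁆` modulo `L (n+2)`
(`⁅h h', g⁆ = h ⁅h', g⁆ h⁻¹ · ⁅h, g⁆`, centrality, and the two factors commute modulo `L (n+2)`). [folklore] -/
theorem mk_commutator_mul_left {n : ℕ} (h : G) {h' : G} (hh' : h' ∈ (⊤ : Subgroup G).lowerCentralSeries n) (g : G) :
    (QuotientGroup.mk ⁅h * h', g⁆ : G ⧸ (⊤ : Subgroup G).lowerCentralSeries (n + 2)) = QuotientGroup.mk ⁅h, g⁆ * QuotientGroup.mk ⁅h', g⁆ := by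
  have hid : ⁅h * h', g⁆ = (h * ⁅h', g⁆ * h⁻¹) * ⁅h, g⁆ := by simp only [commutatorElement_def]; group
  have hsw : (QuotientGroup.mk (⁅h', g⁆ * ⁅h, g⁆) : G ⧸ (⊤ : Subgroup G).lowerCentralSeries (n + 2)) = QuotientGroup.mk (⁅h, g⁆ * ⁅h', g⁆) :=
    mk_mul_comm (n := n + 1) (commutator_mem_L_succ hh' g) _
  rw [hid, QuotientGroup.mk_mul, mk_conj_commutator hh', ← QuotientGroup.mk_mul, hsw, QuotientGroup.mk_mul]

/-- Power law in the right variable: `⁅h, g ^ k⁆ ≡ ⁅h, g⁆ ^ k` modulo `L (n+2)` (the right pairing is a homomorphism). [folklore] -/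
theorem mk_commutator_zpow_right {n : ℕ} {h : G} (hh : h ∈ (⊤ : Subgroup G).lowerCentralSeries n) (g : G) (k : ℤ) :
    (QuotientGroup.mk ⁅h, g ^ k⁆ : G ⧸ (⊤ : Subgroup G).lowerCentralSeries (n + 2)) = (QuotientGroup.mk ⁅h, g⁆) ^ k := by
  let F : G →* G ⧸ (⊤ : Subgroup G).lowerCentralSeries (n + 2) := MonoidHom.mk' (fun x => QuotientGroup.mk ⁅h, x⁆) fun a b => mk_commutator_mul_right hh a b
  exact map_zpow F g k

/-- Power law in the left variable: `⁅h ^ k, g⁆ ≡ ⁅h, g⁆ ^ k` modulo `L (n+2)` for `h ∈ L n` (the left pairing is a homomorphism on `L n`).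
[folklore] -/
theorem mk_commutator_zpow_left {n : ℕ} {h : G} (hh : h ∈ (⊤ : Subgroup G).lowerCentralSeries n) (g : G) (k : ℤ) :
    (QuotientGroup.mk ⁅h ^ k, g⁆ : G ⧸ (⊤ : Subgroup G).lowerCentralSeries (n + 2)) = (QuotientGroup.mk ⁅h, g⁆) ^ k := by
  let F : (⊤ : Subgroup G).lowerCentralSeries n →* G ⧸ (⊤ : Subgroup G).lowerCentralSeries (n + 2) :=
    MonoidHom.mk' (fun x : (⊤ : Subgroup G).lowerCentralSeries n => QuotientGroup.mk ⁅(x : G), g⁆) fun a b => mk_commutator_mul_left (a : G) b.2 g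
  have e := map_zpow F ⟨h, hh⟩ k
  have e1 : F ⟨h, hh⟩ = QuotientGroup.mk ⁅h, g⁆ := rfl
  have e2 : F (⟨h, hh⟩ ^ k) = QuotientGroup.mk ⁅h ^ k, g⁆ := by
    show QuotientGroup.mk ⁅(((⟨h, hh⟩ : (⊤ : Subgroup G).lowerCentralSeries n) ^ k : (⊤ : Subgroup G).lowerCentralSeries n) : G), g⁆ = _; rw [SubgroupClass.coe_zpow]
  rw [e1, e2] at e
  exact e

/-- Reduction in the left variable to a coset representative: `⁅h ℓ, g⁆ ≡ ⁅h, g⁆` modulo `L (n+2)` for `ℓ ∈ L (n+1)`. [folklore] -/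
theorem mk_commutator_mul_left_of_mem {n : ℕ} (h : G) {ℓ : G} (hℓ : ℓ ∈ (⊤ : Subgroup G).lowerCentralSeries (n + 1)) (g : G) :
    (QuotientGroup.mk ⁅h * ℓ, g⁆ : G ⧸ (⊤ : Subgroup G).lowerCentralSeries (n + 2)) = QuotientGroup.mk ⁅h, g⁆ := by
  rw [mk_commutator_mul_left h (L_succ_le n hℓ) g, mk_commutator_eq_one_of_mem hℓ, mul_one]

/-! ## §3 Finitely many cosets of `L (n+1)` cover `L n` -/

/-- From a finite set `T ⊆ G ⧸ L (n+2)` containing the image of `L (n+1)`: finitely many coset representatives of `L (n+1)` modulo `L (n+2)`.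
[folklore] -/
theorem cover_of_image_subset {n : ℕ} {T : Set (G ⧸ (⊤ : Subgroup G).lowerCentralSeries (n + 2))} (hT : T.Finite)
    (hsub : ∀ x ∈ (⊤ : Subgroup G).lowerCentralSeries (n + 1), (QuotientGroup.mk x : G ⧸ (⊤ : Subgroup G).lowerCentralSeries (n + 2)) ∈ T) :
    ∃ F : Finset G, (∀ h ∈ F, h ∈ (⊤ : Subgroup G).lowerCentralSeries (n + 1)) ∧
      ∀ x ∈ (⊤ : Subgroup G).lowerCentralSeries (n + 1), ∃ h ∈ F, h⁻¹ * x ∈ (⊤ : Subgroup G).lowerCentralSeries (n + 2) := by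
  classical
  let rep : G ⧸ (⊤ : Subgroup G).lowerCentralSeries (n + 2) → G := fun q =>
    if hq : ∃ x ∈ (⊤ : Subgroup G).lowerCentralSeries (n + 1), (QuotientGroup.mk x : G ⧸ (⊤ : Subgroup G).lowerCentralSeries (n + 2)) = q then hq.choose else 1
  have hrep_mem : ∀ q, rep q ∈ (⊤ : Subgroup G).lowerCentralSeries (n + 1) := fun q => by
    by_cases hq : ∃ x ∈ (⊤ : Subgroup G).lowerCentralSeries (n + 1), (QuotientGroup.mk x : G ⧸ (⊤ : Subgroup G).lowerCentralSeries (n + 2)) = q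
    · simp only [rep, dif_pos hq]; exact hq.choose_spec.1
    · simp only [rep, dif_neg hq]; exact one_mem _
  refine ⟨hT.toFinset.image rep, fun h hh => ?_, fun x hx => ?_⟩
  · obtain ⟨q, -, rfl⟩ := Finset.mem_image.1 hh
    exact hrep_mem q
  · refine ⟨rep (QuotientGroup.mk x), Finset.mem_image.2 ⟨_, hT.mem_toFinset.2 (hsub x hx), rfl⟩, ?_⟩
    have hq : ∃ y ∈ (⊤ : Subgroup G).lowerCentralSeries (n + 1),
        (QuotientGroup.mk y : G ⧸ (⊤ : Subgroup G).lowerCentralSeries (n + 2)) = QuotientGroup.mk x := ⟨x, hx, rfl⟩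
    have hspec := hq.choose_spec.2
    rw [← QuotientGroup.eq]
    simp only [rep, dif_pos hq]
    exact hspec

/-- Pigeonhole: if `L n` is covered by the cosets `h L (n+1)`, `h ∈ F` (`F` finite), then every `h ∈ L n` has a power `h ^ M ∈ L (n+1)`, `M ≥ 1`.
[folklore] -/
theorem exists_pow_mem_of_cover {n : ℕ} (F : Finset G)
    (hcov : ∀ x ∈ (⊤ : Subgroup G).lowerCentralSeries n, ∃ h ∈ F, h⁻¹ * x ∈ (⊤ : Subgroup G).lowerCentralSeries (n + 1)) {h : G}
    (hh : h ∈ (⊤ : Subgroup G).lowerCentralSeries n) : ∃ M : ℕ, 0 < M ∧ h ^ M ∈ (⊤ : Subgroup G).lowerCentralSeries (n + 1) := by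
  classical
  choose f hf hfmem using fun i : ℕ => hcov (h ^ i) (pow_mem hh i)
  have hlt : F.card < (Finset.range (F.card + 1)).card := by rw [Finset.card_range]; exact Nat.lt_succ_self _
  obtain ⟨i, -, j, -, hne, hij⟩ := Finset.exists_ne_map_eq_of_card_lt_of_maps_to hlt fun i _ => hf i
  -- from `f i = f j`: `(h ^ i)⁻¹ * h ^ j ∈ (⊤ : Subgroup G).lowerCentralSeries (n+1)`, and symmetrically
  have key : ∀ i j : ℕ, f i = f j → i < j → ∃ M : ℕ, 0 < M ∧ h ^ M ∈ (⊤ : Subgroup G).lowerCentralSeries (n + 1) := by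
    intro i j hij hlt
    refine ⟨j - i, Nat.sub_pos_of_lt hlt, ?_⟩
    have hmem := mul_mem (inv_mem (hfmem i)) (hfmem j)
    rw [hij, show ((f j)⁻¹ * h ^ i)⁻¹ * ((f j)⁻¹ * h ^ j) = (h ^ i)⁻¹ * h ^ j by group] at hmem
    rwa [← zpow_natCast, ← zpow_natCast, ← zpow_neg, ← zpow_add, neg_add_eq_sub, ← Nat.cast_sub hlt.le, zpow_natCast] at hmem
  rcases Nat.lt_or_gt_of_ne hne with hlt | hgt
  · exact key i j hij hlt
  · exact key j i hij.symm hgt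

/-- **The inductive step**: `G = ⟨A⟩` with `A` finite and a finite coset cover of `L n` modulo `L (n+1)` give a finite coset cover of `L (n+1)` modulo
`L (n+2)` — `L (n+1)/L (n+2)` is generated by the finitely many pairwise commuting torsion elements `⁅h_j, a⁆`, `h_j ∈ F`, `a ∈ A`. [folklore] -/
theorem covered_succ (A : Finset G) (hA : Subgroup.closure (A : Set G) = ⊤) {n : ℕ} (F : Finset G) (hF : ∀ h ∈ F, h ∈ (⊤ : Subgroup G).lowerCentralSeries n)
    (hcov : ∀ x ∈ (⊤ : Subgroup G).lowerCentralSeries n, ∃ h ∈ F, h⁻¹ * x ∈ (⊤ : Subgroup G).lowerCentralSeries (n + 1)) :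
    ∃ F' : Finset G, (∀ h ∈ F', h ∈ (⊤ : Subgroup G).lowerCentralSeries (n + 1)) ∧
      ∀ x ∈ (⊤ : Subgroup G).lowerCentralSeries (n + 1), ∃ h ∈ F', h⁻¹ * x ∈ (⊤ : Subgroup G).lowerCentralSeries (n + 2) := by
  classical
  -- the generators
  let E : Finset (G ⧸ (⊤ : Subgroup G).lowerCentralSeries (n + 2)) := (F ×ˢ A).image fun p => QuotientGroup.mk ⁅p.1, p.2⁆
  have hEcentral : ∀ q ∈ E, ∀ r : G ⧸ (⊤ : Subgroup G).lowerCentralSeries (n + 2), Commute q r := by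
    intro q hq r
    obtain ⟨⟨h, a⟩, hp, rfl⟩ := Finset.mem_image.1 hq
    obtain ⟨hF', -⟩ := Finset.mem_product.1 hp
    induction r using QuotientGroup.induction_on with
    | H g =>
      show (QuotientGroup.mk ⁅h, a⁆ : G ⧸ (⊤ : Subgroup G).lowerCentralSeries (n + 2)) * QuotientGroup.mk g = QuotientGroup.mk g * QuotientGroup.mk ⁅h, a⁆
      rw [← QuotientGroup.mk_mul, ← QuotientGroup.mk_mul]; exact mk_mul_comm (commutator_mem_L_succ (hF h hF') a) g
  have hEfin : ∀ q ∈ E, IsOfFinOrder q := by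
    intro q hq
    obtain ⟨⟨h, a⟩, hp, rfl⟩ := Finset.mem_image.1 hq
    obtain ⟨hF', -⟩ := Finset.mem_product.1 hp
    obtain ⟨M, hM, hhM⟩ := exists_pow_mem_of_cover F hcov (hF h hF')
    refine isOfFinOrder_iff_pow_eq_one.2 ⟨M, hM, ?_⟩
    show (QuotientGroup.mk ⁅h, a⁆ : G ⧸ (⊤ : Subgroup G).lowerCentralSeries (n + 2)) ^ M = 1
    rw [← zpow_natCast, ← mk_commutator_zpow_left (hF h hF'), zpow_natCast]
    exact mk_commutator_eq_one_of_mem hhM a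
  have hfin := finite_closure_of_comm E (fun x hx y _ => hEcentral x hx y) hEfin
  refine cover_of_image_subset hfin fun x hx => ?_
  -- `mk x ∈ Subgroup.closure E` for `x ∈ (⊤ : Subgroup G).lowerCentralSeries (n+1) = ⁅(⊤ : Subgroup G).lowerCentralSeries n, G⁆`
  have hgen : ∀ (h' : G), h' ∈ (⊤ : Subgroup G).lowerCentralSeries n → ∀ g : G,
      (QuotientGroup.mk ⁅h', g⁆ : G ⧸ (⊤ : Subgroup G).lowerCentralSeries (n + 2)) ∈ Subgroup.closure (E : Set _) := by
    intro h' hh' g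
    obtain ⟨h, hhF, hℓ⟩ := hcov h' hh'
    have e1 : (QuotientGroup.mk ⁅h', g⁆ : G ⧸ (⊤ : Subgroup G).lowerCentralSeries (n + 2)) = QuotientGroup.mk ⁅h, g⁆ := by
      rw [show h' = h * (h⁻¹ * h') by group]; exact mk_commutator_mul_left_of_mem h hℓ g
    let F : G →* G ⧸ (⊤ : Subgroup G).lowerCentralSeries (n + 2) := MonoidHom.mk' (fun x => QuotientGroup.mk ⁅h, x⁆) fun a b => mk_commutator_mul_right (hF h hhF) a b
    have hle : (Subgroup.closure (A : Set G)).map F ≤ Subgroup.closure (E : Set _) := by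
      rw [MonoidHom.map_closure]
      refine (Subgroup.closure_le _).2 ?_
      rintro _ ⟨a, ha, rfl⟩
      exact Subgroup.subset_closure (Finset.mem_coe.2 (Finset.mem_image.2 ⟨(h, a), Finset.mem_product.2 ⟨hhF, ha⟩, rfl⟩))
    rw [e1]
    exact hle ⟨g, by rw [hA]; exact Subgroup.mem_top g, rfl⟩
  have hx' : x ∈ Subgroup.closure {y : G | ∃ p ∈ (⊤ : Subgroup G).lowerCentralSeries n, ∃ q ∈ (⊤ : Subgroup G), ⁅p, q⁆ = y} := by
    have e : (⊤ : Subgroup G).lowerCentralSeries (n + 1) = ⁅(⊤ : Subgroup G).lowerCentralSeries n, (⊤ : Subgroup G)⁆ := Subgroup.lowerCentralSeries_succ ⊤ n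
    rwa [e, Subgroup.commutator_def] at hx
  clear hx
  induction hx' using Subgroup.closure_induction with
  | mem y hy =>
    obtain ⟨p, hp, q, -, rfl⟩ := hy
    exact hgen p hp q
  | one => rw [QuotientGroup.mk_one]; exact one_mem _
  | mul y z _ _ hy hz => rw [QuotientGroup.mk_mul]; exact mul_mem hy hz
  | inv y _ hy => rw [QuotientGroup.mk_inv]; exact inv_mem hy

/-- **The base**: `G = ⟨A⟩` with `A` finite, and `g ^ μ * z ^ {k(g)} ∈ [G,G]` for all `g` (`μ ≠ 0`) give a finite coset cover of `L 1` modulo `L 2` —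
`[G,G]/γ₃` is generated by the commuting elements `⁅a, a'⁆`, and `⁅a, a'⁆ ^ {μ²} ≡ ⁅a ^ μ, a' ^ μ⁆ ≡ ⁅z, z⁆ ^ {kk'} = 1`. [folklore] -/
theorem covered_one (A : Finset G) (hA : Subgroup.closure (A : Set G) = ⊤) (z : G) (μ : ℤ) (hμ : μ ≠ 0)
    (hz : ∀ g : G, ∃ k : ℤ, g ^ μ * z ^ k ∈ (⊤ : Subgroup G).lowerCentralSeries 1) :
    ∃ F : Finset G, (∀ h ∈ F, h ∈ (⊤ : Subgroup G).lowerCentralSeries 1) ∧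
      ∀ x ∈ (⊤ : Subgroup G).lowerCentralSeries 1, ∃ h ∈ F, h⁻¹ * x ∈ (⊤ : Subgroup G).lowerCentralSeries 2 := by
  classical
  have htop : ∀ g : G, g ∈ (⊤ : Subgroup G).lowerCentralSeries 0 := fun g => Subgroup.mem_top g
  -- reduction of `⁅g ^ μ, y⁆` to a power of `⁅z, y⁆`
  have hred : ∀ g y : G, ∃ k : ℤ, (QuotientGroup.mk ⁅g ^ μ, y⁆ : G ⧸ (⊤ : Subgroup G).lowerCentralSeries 2) = (QuotientGroup.mk ⁅z, y⁆) ^ (-k) := by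
    intro g y
    obtain ⟨k, hk⟩ := hz g
    refine ⟨k, ?_⟩
    have hw : z ^ k * (g ^ μ * z ^ k) * (z ^ k)⁻¹ ∈ (⊤ : Subgroup G).lowerCentralSeries 1 :=
      (inferInstance : ((⊤ : Subgroup G).lowerCentralSeries 1).Normal).conj_mem _ hk (z ^ k)
    have e : g ^ μ = z ^ (-k) * (z ^ k * (g ^ μ * z ^ k) * (z ^ k)⁻¹) := by group
    rw [e, mk_commutator_mul_left_of_mem (n := 0) (z ^ (-k)) hw, mk_commutator_zpow_left (n := 0) (htop z)]
  let E : Finset (G ⧸ (⊤ : Subgroup G).lowerCentralSeries 2) := (A ×ˢ A).image fun p => QuotientGroup.mk ⁅p.1, p.2⁆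
  have hEcentral : ∀ q ∈ E, ∀ r : G ⧸ (⊤ : Subgroup G).lowerCentralSeries 2, Commute q r := by
    intro q hq r
    obtain ⟨⟨a, a'⟩, -, rfl⟩ := Finset.mem_image.1 hq
    induction r using QuotientGroup.induction_on with
    | H g =>
      show (QuotientGroup.mk ⁅a, a'⁆ : G ⧸ (⊤ : Subgroup G).lowerCentralSeries 2) * QuotientGroup.mk g = QuotientGroup.mk g * QuotientGroup.mk ⁅a, a'⁆
      rw [← QuotientGroup.mk_mul, ← QuotientGroup.mk_mul]; exact mk_mul_comm (commutator_mem_L_succ (htop a) a') g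
  have hEfin : ∀ q ∈ E, IsOfFinOrder q := by
    intro q hq
    obtain ⟨⟨a, a'⟩, -, rfl⟩ := Finset.mem_image.1 hq
    refine isOfFinOrder_iff_zpow_eq_one.2 ⟨μ * μ, mul_ne_zero hμ hμ, ?_⟩
    show (QuotientGroup.mk ⁅a, a'⁆ : G ⧸ (⊤ : Subgroup G).lowerCentralSeries 2) ^ (μ * μ) = 1
    rw [zpow_mul, ← mk_commutator_zpow_left (n := 0) (htop a), ← mk_commutator_zpow_right (n := 0) (htop _)]
    obtain ⟨k, hk⟩ := hred a (a' ^ μ)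
    rw [hk, show ⁅z, a' ^ μ⁆ = ⁅a' ^ μ, z⁆⁻¹ from (commutatorElement_inv _ _).symm, QuotientGroup.mk_inv, inv_zpow']
    obtain ⟨k', hk'⟩ := hred a' z
    rw [hk', commutatorElement_self, QuotientGroup.mk_one, one_zpow, one_zpow]
  have hfin := finite_closure_of_comm E (fun x hx y _ => hEcentral x hx y) hEfin
  refine cover_of_image_subset (n := 0) hfin fun x hx => ?_
  -- generation, step 1: `mk ⁅g, a⁆ ∈ Subgroup.closure E` for a letter `a` (left pairing over `G = ⟨A⟩`)
  have hgen₁ : ∀ (a : G), a ∈ A → ∀ g : G, (QuotientGroup.mk ⁅g, a⁆ : G ⧸ (⊤ : Subgroup G).lowerCentralSeries 2) ∈ Subgroup.closure (E : Set _) := by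
    intro a ha g
    let F : G →* G ⧸ (⊤ : Subgroup G).lowerCentralSeries 2 := MonoidHom.mk' (fun x => QuotientGroup.mk ⁅x, a⁆) fun x y => mk_commutator_mul_left (n := 0) x (htop y) a
    have hle : (Subgroup.closure (A : Set G)).map F ≤ Subgroup.closure (E : Set _) := by
      rw [MonoidHom.map_closure]
      refine (Subgroup.closure_le _).2 ?_
      rintro _ ⟨a', ha', rfl⟩
      exact Subgroup.subset_closure (Finset.mem_coe.2 (Finset.mem_image.2 ⟨(a', a), Finset.mem_product.2 ⟨ha', ha⟩, rfl⟩))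
    exact hle ⟨g, by rw [hA]; exact Subgroup.mem_top g, rfl⟩
  -- generation, step 2: `mk ⁅g, y⁆ ∈ Subgroup.closure E` for all `g, y` (right pairing over `G = ⟨A⟩`)
  have hgen₂ : ∀ g y : G, (QuotientGroup.mk ⁅g, y⁆ : G ⧸ (⊤ : Subgroup G).lowerCentralSeries 2) ∈ Subgroup.closure (E : Set _) := by
    intro g y
    let F : G →* G ⧸ (⊤ : Subgroup G).lowerCentralSeries 2 := MonoidHom.mk' (fun x => QuotientGroup.mk ⁅g, x⁆) fun a b => mk_commutator_mul_right (n := 0) (htop g) a b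
    have hle : (Subgroup.closure (A : Set G)).map F ≤ Subgroup.closure (E : Set _) := by
      rw [MonoidHom.map_closure]
      refine (Subgroup.closure_le _).2 ?_
      rintro _ ⟨a, ha, rfl⟩
      exact hgen₁ a ha g
    exact hle ⟨y, by rw [hA]; exact Subgroup.mem_top y, rfl⟩
  have hx' : x ∈ Subgroup.closure {y : G | ∃ p ∈ (⊤ : Subgroup G).lowerCentralSeries 0, ∃ q ∈ (⊤ : Subgroup G), ⁅p, q⁆ = y} := by
    have e : (⊤ : Subgroup G).lowerCentralSeries 1 = ⁅(⊤ : Subgroup G).lowerCentralSeries 0, (⊤ : Subgroup G)⁆ := Subgroup.lowerCentralSeries_succ ⊤ 0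
    rwa [e, Subgroup.commutator_def] at hx
  clear hx
  induction hx' using Subgroup.closure_induction with
  | mem y hy =>
    obtain ⟨p, -, q, -, rfl⟩ := hy
    exact hgen₂ p q
  | one => rw [QuotientGroup.mk_one]; exact one_mem _
  | mul y z _ _ hy hz => rw [QuotientGroup.mk_mul]; exact mul_mem hy hz
  | inv y _ hy => rw [QuotientGroup.mk_inv]; exact inv_mem hy

/-! ## §4 The commutator subgroup is finite -/

/-- Finite coset covers of `L (n+1)` modulo `L (n+2)` for every `n`. [folklore] -/
theorem covered_all (A : Finset G) (hA : Subgroup.closure (A : Set G) = ⊤) (z : G) (μ : ℤ) (hμ : μ ≠ 0)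
    (hz : ∀ g : G, ∃ k : ℤ, g ^ μ * z ^ k ∈ (⊤ : Subgroup G).lowerCentralSeries 1) (n : ℕ) :
    ∃ F : Finset G, (∀ h ∈ F, h ∈ (⊤ : Subgroup G).lowerCentralSeries (n + 1)) ∧
      ∀ x ∈ (⊤ : Subgroup G).lowerCentralSeries (n + 1), ∃ h ∈ F, h⁻¹ * x ∈ (⊤ : Subgroup G).lowerCentralSeries (n + 2) := by
  induction n with
  | zero => exact covered_one A hA z μ hμ hz
  | succ n ih =>
    obtain ⟨F, hF, hcov⟩ := ih
    exact covered_succ A hA F hF hcov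

/-- **THEOREM (group theory).  A finitely generated nilpotent group whose abelianisation is cyclic up to bounded torsion — `g ^ μ z ^ {k(g)} ∈ [G,G]`
for all `g`, some fixed `z` and `μ ≠ 0` — has FINITE commutator subgroup.** [cite: MilnorSolvableGrowth1968, Lemma 1 pp. 447–448] -/
theorem commutator_finite (A : Finset G) (hA : Subgroup.closure (A : Set G) = ⊤) {c : ℕ} (hnil : (⊤ : Subgroup G).lowerCentralSeries c = ⊥)
    (z : G) (μ : ℤ) (hμ : μ ≠ 0) (hz : ∀ g : G, ∃ k : ℤ, g ^ μ * z ^ k ∈ commutator G) :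
    ((commutator G : Subgroup G) : Set G).Finite := by
  classical
  rw [← Subgroup.top_lowerCentralSeries_one] at hz ⊢
  have hbot : ∀ m : ℕ, (⊤ : Subgroup G).lowerCentralSeries m = ⊥ →
      (((⊤ : Subgroup G).lowerCentralSeries m : Subgroup G) : Set G).Finite := fun m hm => by
    rw [hm]; exact (Set.finite_singleton (1 : G)).subset fun x hx => by simpa using hx
  -- descending induction from `L c = ⊥`
  have key : ∀ d n : ℕ, n + d = c → 1 ≤ n → (((⊤ : Subgroup G).lowerCentralSeries n : Subgroup G) : Set G).Finite := by
    intro d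
    induction d with
    | zero =>
      intro n hn _
      rw [add_zero] at hn
      subst hn
      exact hbot n hnil
    | succ d ih =>
      intro n hn h1
      have hfin : (((⊤ : Subgroup G).lowerCentralSeries (n + 1) : Subgroup G) : Set G).Finite := ih (n + 1) (by omega) (by omega)
      obtain ⟨m, rfl⟩ : ∃ m, n = m + 1 := ⟨n - 1, by omega⟩
      obtain ⟨F, -, hF⟩ := covered_all A hA z μ hμ hz m
      refine (Set.Finite.image2 (fun h y => h * y) (Finset.finite_toSet F) hfin).subset fun x hx => ?_
      obtain ⟨h, hh, hmem⟩ := hF x hx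
      exact ⟨h, Finset.mem_coe.2 hh, h⁻¹ * x, hmem, by show h * (h⁻¹ * x) = x; group⟩
  by_cases hc : c ≤ 1
  · have hle : (⊤ : Subgroup G).lowerCentralSeries 1 ≤ (⊤ : Subgroup G).lowerCentralSeries c := Subgroup.lowerCentralSeries_antitone ⊤ hc
    rw [show (⊤ : Subgroup G).lowerCentralSeries c = ⊥ from hnil, le_bot_iff] at hle
    exact hbot 1 hle
  · exact key (c - 1) 1 (by omega) le_rfl

end NilBetti
end Summit.CriticalPhenomena.PercolationContinuityZ3.Theorems.Transplant
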